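import Literature.Geometry.Lorentzian.DataEmbeddingConstraints
import Literature.Geometry.Lorentzian.MeanCurvatureRegularity
import Literature.Geometry.Lorentzian.SecondFundamentalFormSymm
import Literature.Geometry.Lorentzian.SecondFundamentalFormLift
import Literature.Geometry.Lorentzian.IsometryProofs
import Literature.Geometry.Lorentzian.LeviCivitaProofs
import Literature.Geometry.Lorentzian.ChartCalculus
import Mathlib.Topology.Algebra.Module.FiniteDimensionBilinear
import Mathlib.Analysis.Calculus.ContDiff.FiniteDimension
import HarnessLib

/-!
# The vacuum initial data set induced on a spacelike immersed chart domain

For a smooth pseudo-Riemannian manifold `(M, g)` (`g` of class `C^∞`, with its Levi-Civita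
connection), a chart domain `U : Opens E'` and a smooth spacelike immersion `f : U → M` with a unit
normal field `ν` of sign `−1` whose lift `y ↦ (f y, ν y) ∈ TM` is smooth, the induced pair
`(h, k) = (f^* g, K_ν)` — `K_ν(v, w) = + g(D_v ν, df w)` the tree's `secondFundamentalForm`
(`Hypersurface.lean`) — is an honest `InitialDataSet` on `U` (`InitialData.lean`): `h` is the
induced Riemannian metric (`inducedRiemannianMetric`, smoothness by
`contMDiff_pullbackBilin_holds`), `k` is symmetric (O'Neill 1983, Ch. 4, Lemma 4.4;
`secondFundamentalForm_symm_holds`) and a smooth section of the bundle of bilinear forms on `TU`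
(O'Neill 1983, Ch. 4, Lemma 4: the shape tensor is a smooth tensor field;
`contMDiffAt_secondFundamentalForm_apply` componentwise, assembled by
`OpensChart.contMDiffAt_bilinSection_iff`). If moreover `Ric(g) = 0` along `f` and
`dim M = dim U + 1`, these data solve the **vacuum constraint equations** (Choquet-Bruhat 2009,
Ch. VI, Thm. 3.3: the Hamiltonian constraint is the twice-traced Gauss equation,
`scalarCurvature_inducedMetric_sub_normSq_add_sq_eq_zero`, the momentum constraint the traced
Codazzi equation, `divergence_sub_mvfderiv_meanCurvature_eq_zero`). Contents:

* `OpensChart.contMDiff_lift_of_contDiffOn` — for a map `f : U → V` between chart domains and a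
  field `ν` along `f` with a representative `N : E' → E` of class `C^n` on `U`, the lift
  `y ↦ (f y, ν y) ∈ TV` is `C^n`;
* `PseudoRiemannianMetric.secondFundamentalForm_comm` — `K_ν(v, w) = K_ν(w, v)` for a normal field
  with smooth lift along a smooth map from a boundaryless manifold;
* `InitialDataSet.isVacuumConstraintSolution_of_eq_induced` — an initial data set `D` on a
  boundaryless manifold `N` whose metric and tensor `k` agree pointwise with `(f^* g, K_ν)` for a
  smooth spacelike immersion `f : N → (Mᵐ⁺¹, g)` with timelike unit normal `ν` (smooth lift) into
  a spacetime with `Ric(g) = 0` along `f` solves the vacuum constraints (the statement of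
  `InitialDataSet.isVacuumConstraintSolution_of_dataEmbedding`, `DataEmbeddingConstraints.lean`,
  freed from the `DataEmbedding` packaging: no time orientation, no embedding property, any model);
* `PseudoRiemannianMetric.contMDiff_bilinSection_of_eq_secondFundamentalForm` — on a chart domain
  `U`, a field of continuous bilinear forms on `TU` agreeing with `K_ν` is a smooth bundle section;
* `PseudoRiemannianMetric.exists_initialDataSet_induced` — the induced `InitialDataSet`
  `(f^* g, K_ν)` on a chart domain exists;
* `PseudoRiemannianMetric.exists_initialDataSet_induced_isVacuumConstraintSolution` — and solves
  the vacuum constraints when `Ric(g) = 0` along `f`.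

Everything is proved; there are no definitions and no named facts. (The Kerr–Schild slice
`{t* = 0}` with its closed-form data is `Kerr.data`, `KerrData.lean`/`KerrSliceFacts.lean`; this
file is the same packaging for an arbitrary smooth spacelike immersion of a chart domain.)

## References

* B. O'Neill, *Semi-Riemannian geometry with applications to relativity*, Academic Press 1983,
  Ch. 4, Lemma 4 (p. 100) and Lemma 4.4 (the shape tensor is a smooth symmetric tensor field).
  [ONeill1983]
* Y. Choquet-Bruhat, *General Relativity and the Einstein Equations*, OUP 2009, Ch. VI, §3,
  Thm. 3.3 (data induced on a spacelike hypersurface of a vacuum spacetime solve the constraints).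
  [ChoquetBruhat2009]
* R. Bartnik, J. Isenberg, *The constraint equations*, Birkhäuser 2004, §2, (2.1)–(2.2).
  [BartnikIsenberg2004]
-/

noncomputable section

open Bundle TopologicalSpace Manifold Set Module
open scoped ContDiff Topology Manifold

namespace Literature.Geometry.Lorentzian

/-! ### The lift of a field with smooth representative -/

namespace OpensChart

variable {E : Type*} [NormedAddCommGroup E] [NormedSpace ℝ E]
  {E' : Type*} [NormedAddCommGroup E'] [NormedSpace ℝ E'] {V : Opens E} {U : Opens E'}

/-- **The lift of a field along a map between chart domains with a `C^n` representative is
`C^n`.** For `f : U → V` of class `C^n` (`U : Opens E'`, `V : Opens E`) and a field `ν` along `f`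
(`ν y ∈ T_{f y} V = E`) with a representative `N : E' → E`, `ν y = N y`, of class `C^n` on `U`,
the lift `y ↦ (f y, ν y) ∈ TV` is `C^n` (the tangent bundle of a chart domain is trivial:
`contMDiffAt_lift_iff`, `contMDiffAt_iff`). This is the regularity hypothesis on the normal of
`secondFundamentalForm_symm`, `contMDiffAt_secondFundamentalForm_apply` and of the Gauss–Codazzi
constraint identities. [folklore] -/
theorem contMDiff_lift_of_contDiffOn {n : WithTop ℕ∞} {f : U → V}
    (hf : ContMDiff 𝓘(ℝ, E') 𝓘(ℝ, E) n f) {ν : NormalField 𝓘(ℝ, E) f} {N : E' → E}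
    (hν : ∀ y : U, ν y = N y) (hN : ContDiffOn ℝ n N (U : Set E')) :
    ContMDiff 𝓘(ℝ, E') 𝓘(ℝ, E).tangent n
      (fun y ↦ (TotalSpace.mk' E (f y) (ν y) : TangentBundle 𝓘(ℝ, E) V)) := fun y ↦
  contMDiffAt_lift_iff.mpr ⟨hf y, (contMDiffAt_iff y (fun x : U ↦ (ν x : E)) N hν).mpr
    (hN.contDiffAt (U.isOpen.mem_nhds y.2))⟩

end OpensChart

/-! ### Symmetry of `K_ν` and the constraints, for a general data manifold -/

section General

variable {E : Type*} [NormedAddCommGroup E] [NormedSpace ℝ E] {H : Type*} [TopologicalSpace H]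
  {I : ModelWithCorners ℝ E H} {M : Type*} [TopologicalSpace M] [ChartedSpace H M]
  [IsManifold I ∞ M] [FiniteDimensional ℝ E]
  (g : PseudoRiemannianMetric I ∞ E (TangentSpace I : M → Type _)) [g.HasLeviCivita]
  {E' : Type*} [NormedAddCommGroup E'] [NormedSpace ℝ E'] {H' : Type*} [TopologicalSpace H']
  {I' : ModelWithCorners ℝ E' H'} {N : Type*} [TopologicalSpace N] [ChartedSpace H' N]
  [IsManifold I' ∞ N] [FiniteDimensional ℝ E'] [I'.Boundaryless] {f : N → M} {ν : NormalField I f}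

/-- **The second fundamental form is symmetric** for a map `f : N → M` of class `C^∞` from a
boundaryless manifold and a field `ν` normal to `f` with `C^∞` lift (every point is an interior
point; `secondFundamentalForm_symm_holds`). O'Neill 1983, Ch. 4, Lemma 4.4; Wald 1984, §10.2.
[cite: ONeill1983, Ch. 4, Lemma 4.4] -/
theorem PseudoRiemannianMetric.secondFundamentalForm_comm (hf : ContMDiff I' I ∞ f)
    (hn : g.IsNormalTo I' f ν)
    (hν : ContMDiff I' I.tangent ∞ (fun x ↦ (TotalSpace.mk' E (f x) (ν x) : TangentBundle I M)))
    (y : N) (v w : TangentSpace I' y) :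
    g.secondFundamentalForm I' f ν y v w = g.secondFundamentalForm I' f ν y w v :=
  haveI : CompleteSpace E := FiniteDimensional.complete ℝ E
  (PseudoRiemannianMetric.secondFundamentalForm_symm_holds (g := g) (I' := I') (N := N)
    (hf.of_le (by exact WithTop.coe_le_coe.2 le_top)) hn
    (hν.of_le (by exact WithTop.coe_le_coe.2 le_top)) (y := y)
    BoundarylessManifold.isInteriorPoint).eq v w

variable [CompleteSpace E] [CompleteSpace E']

/-- **Data agreeing with the data induced on a spacelike hypersurface of a vacuum spacetime solve
the vacuum constraint equations** (Choquet-Bruhat 2009, Ch. VI, Thm. 3.3, necessity; Wald 1984,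
(10.2.28)–(10.2.30); Bartnik–Isenberg 2004, (2.1)–(2.2) with `μ = 0`, `J = 0`). Let
`f : (N, ·) → (Mᵐ⁺¹, g)` be a smooth spacelike immersion of a boundaryless `m`-manifold with a unit
normal field `ν` of sign `−1` whose lift to `TM` is `C^∞`, with `Ric(g) = 0` along `f`, and let
`D = (h, k)` be an initial data set on `N` with `h_y(v, w) = g(df v, df w)` and `k_y = K_ν(y)`
pointwise. Then `R(h) − |k|²_h + (tr_h k)² = 0` (twice-traced Gauss equation,
`scalarCurvature_inducedMetric_sub_normSq_add_sq_eq_zero`) and `div_h k − d(tr_h k) = 0` (traced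
Codazzi equation, `divergence_sub_mvfderiv_meanCurvature_eq_zero`), read through `f^* g = h`
(`scalarCurvature_eq_of_metric_eq`, `normSq_eq_of_metric_eq`, `divergence_eq_of_metric_eq`) and
`tr_h k = H`; this is `InitialDataSet.isVacuumConstraintSolution_of_dataEmbedding` without the
`DataEmbedding` packaging (no time orientation, any model). [cite: ChoquetBruhat2009, Ch. VI, Thm. 3.3] -/
theorem InitialDataSet.isVacuumConstraintSolution_of_eq_induced (D : InitialDataSet I' N)
    (hfi : g.IsSpacelikeImmersion I' f) (hun : g.IsUnitNormal I' f ν (-1))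
    (hν : ContMDiff I' I.tangent ∞ (fun x ↦ (TotalSpace.mk' E (f x) (ν x) : TangentBundle I M)))
    {m : ℕ} (hm : finrank ℝ E' = m) (hm1 : finrank ℝ E = m + 1)
    (hRic : ∀ y : N, g.ricci (f y) = 0)
    (hDh : ∀ (y : N) (v w : TangentSpace I' y),
      D.h.inner y v w = g.val (f y) (mfderiv I' I f y v) (mfderiv I' I f y w))
    (hDk : ∀ (y : N) (v w : TangentSpace I' y),
      D.k y v w = g.secondFundamentalForm I' f ν y v w)
    [D.metric.HasLeviCivita] : D.IsVacuumConstraintSolution := by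
  have hpb : PseudoRiemannianMetric.contMDiff_pullbackBilin I M I' N ∞ := fun f' hf' g' ↦
    PseudoRiemannianMetric.contMDiff_pullbackBilin_holds f' hf' g'
  -- `f^* g = h` as metrics
  have hmet : g.inducedMetric f hpb hfi = D.metric := by
    ext y v w
    rw [PseudoRiemannianMetric.inducedMetric_val, PseudoRiemannianMetric.inducedBilin_apply,
      InitialDataSet.val_metric, hDh]
  haveI hindLC := (g.inducedMetric f hpb hfi).hasLeviCivita
  -- `K_ν = k`
  have hK : ∀ y, g.secondFundamentalForm I' f ν y = D.kBilin y := fun y ↦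
    LinearMap.ext₂ fun v w ↦ by rw [InitialDataSet.kBilin_apply, hDk]
  -- `H = tr_h k` as functions
  have hH : g.meanCurvature f hpb hfi ν = D.traceK := by
    funext y
    rw [PseudoRiemannianMetric.meanCurvature, InitialDataSet.traceK, hK,
      PseudoRiemannianMetric.trace_congr (congrArg (fun g' ↦ PseudoRiemannianMetric.val g' y) hmet)]
  intro x
  constructor
  · -- Hamiltonian constraint: twice-traced Gauss equation
    have hG := PseudoRiemannianMetric.scalarCurvature_inducedMetric_sub_normSq_add_sq_eq_zero g hpb
      hfi hν hun hm hm1 x (hRic x)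
    rw [InitialDataSet.hamiltonianConstraintFn, InitialDataSet.normSqK, ← congrFun hH x,
      PseudoRiemannianMetric.meanCurvature, ← hK,
      ← PseudoRiemannianMetric.scalarCurvature_eq_of_metric_eq hmet hindLC inferInstance x,
      ← PseudoRiemannianMetric.normSq_eq_of_metric_eq hmet x]
    exact hG
  · -- momentum constraint: traced Codazzi equation
    refine LinearMap.ext fun v ↦ ?_
    have hKd : MDifferentiableAt I' (I'.prod 𝓘(ℝ, E' →L[ℝ] E' →L[ℝ] ℝ))
        (fun y ↦ TotalSpace.mk' (E' →L[ℝ] E' →L[ℝ] ℝ)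
          (E := fun y : N ↦ TangentSpace I' y →L[ℝ] TangentSpace I' y →L[ℝ] ℝ) y (D.k y)) x :=
      (D.contMDiff_k x).mdifferentiableAt (by simp)
    have hM := PseudoRiemannianMetric.divergence_sub_mvfderiv_meanCurvature_eq_zero g hpb hfi hν
      hun (by norm_num) hm hm1 D.k hDk x hKd (hRic x) v
    rw [InitialDataSet.momentumConstraintFn_apply, LinearMap.zero_apply,
      ← PseudoRiemannianMetric.divergence_eq_of_metric_eq hmet hindLC inferInstance D.k x]
    rw [hH] at hM
    exact hM

end General

/-! ### The induced data of a spacelike immersion of a chart domain -/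

namespace PseudoRiemannianMetric

variable {E : Type*} [NormedAddCommGroup E] [NormedSpace ℝ E] {H : Type*} [TopologicalSpace H]
  {I : ModelWithCorners ℝ E H} {M : Type*} [TopologicalSpace M] [ChartedSpace H M]
  [IsManifold I ∞ M] [FiniteDimensional ℝ E] [CompleteSpace E]
  (g : PseudoRiemannianMetric I ∞ E (TangentSpace I : M → Type _)) [g.HasLeviCivita]
  {E' : Type*} [NormedAddCommGroup E'] [NormedSpace ℝ E'] [FiniteDimensional ℝ E'] {U : Opens E'}
  {f : U → M} {ν : NormalField I f}

/-- **The second fundamental form of a smooth map from a chart domain, with smooth normal field,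
is a smooth section of the bundle of bilinear forms.** For `f : U → M` of class `C^∞`
(`U : Opens E'`), a field `ν` along `f` with `C^∞` lift `y ↦ (f y, ν y) ∈ TM`, and a field `Kc` of
continuous bilinear forms on `TU` agreeing with `K_ν` (`K_ν(v, w) = g(D_v ν, df w)`,
`secondFundamentalForm`), `y ↦ Kc y` is a `C^∞` section of `Hom(TU, Hom(TU, ℝ))`: by
`OpensChart.contMDiffAt_bilinSection_iff` this is ordinary smoothness of the representative
`E' → (E' →L E' →L ℝ)` (extended by `0` off `U`), which by `contDiffOn_clm_apply` reduces to the
smoothness of the components `y ↦ K_ν(v, w)` against constant vectors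
(`contMDiffAt_secondFundamentalForm_apply`). O'Neill 1983, Ch. 4, Lemma 4 (p. 100: the shape
tensor is a smooth tensor field). [cite: ONeill1983, Ch. 4, Lemma 4] -/
theorem contMDiff_bilinSection_of_eq_secondFundamentalForm (hf : ContMDiff 𝓘(ℝ, E') I ∞ f)
    (hν : ContMDiff 𝓘(ℝ, E') I.tangent ∞
      (fun x ↦ (TotalSpace.mk' E (f x) (ν x) : TangentBundle I M)))
    (Kc : Π y : U, TangentSpace 𝓘(ℝ, E') y →L[ℝ] TangentSpace 𝓘(ℝ, E') y →L[ℝ] ℝ)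
    (hKc : ∀ (y : U) (v w : TangentSpace 𝓘(ℝ, E') y),
      Kc y v w = g.secondFundamentalForm 𝓘(ℝ, E') f ν y v w) :
    ContMDiff 𝓘(ℝ, E') (𝓘(ℝ, E').prod 𝓘(ℝ, E' →L[ℝ] E' →L[ℝ] ℝ)) ∞
      (fun y : U ↦ TotalSpace.mk' (E' →L[ℝ] E' →L[ℝ] ℝ)
        (E := fun x : U ↦ TangentSpace 𝓘(ℝ, E') x →L[ℝ] TangentSpace 𝓘(ℝ, E') x →L[ℝ] ℝ)
        y (Kc y)) := by
  classical
  intro y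
  -- the representative, extended by zero off the (open) chart domain
  set G : E' → E' →L[ℝ] E' →L[ℝ] ℝ := fun z ↦ if h : z ∈ U then Kc ⟨z, h⟩ else 0 with hG
  have hrep : ∀ z : U, Kc z = G z := fun z ↦ by
    rw [hG]
    simp only [SetLike.coe_mem, ↓reduceDIte]
  rw [OpensChart.contMDiffAt_bilinSection_iff y _ G hrep]
  suffices hOn : ContDiffOn ℝ ∞ G (U : Set E') from hOn.contDiffAt (U.isOpen.mem_nhds y.2)
  -- smoothness on `U`, componentwise
  refine contDiffOn_clm_apply.mpr fun v ↦ contDiffOn_clm_apply.mpr fun w ↦ ?_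
  intro z hz
  refine ContDiffAt.contDiffWithinAt ?_
  have hV := fun u : E' ↦ (OpensChart.contMDiffAt_section_iff (n := ∞) (⟨z, hz⟩ : U)
    (fun x : U ↦ (u : TangentSpace 𝓘(ℝ, E') x))).mpr contMDiffAt_const
  have h := g.contMDiffAt_secondFundamentalForm_apply (I' := 𝓘(ℝ, E')) hf hν
    (V := fun _ : U ↦ v) (W := fun _ : U ↦ w) (y₀ := ⟨z, hz⟩) (hV v) (hV w)
  have hfun : (fun x : U ↦ Kc x v w) =
      fun x : U ↦ g.secondFundamentalForm 𝓘(ℝ, E') f ν x v w :=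
    funext fun x ↦ hKc x v w
  have h' : ContMDiffAt 𝓘(ℝ, E') 𝓘(ℝ, ℝ) ∞ (fun x : U ↦ Kc x v w) ⟨z, hz⟩ := by
    rw [hfun]
    exact h
  exact (OpensChart.contMDiffAt_iff (⟨z, hz⟩ : U) (fun x : U ↦ Kc x v w) (fun z ↦ G z v w)
    (fun x ↦ congrArg (fun B : E' →L[ℝ] E' →L[ℝ] ℝ ↦ B v w) (hrep x))).mp h'

/-- **The induced initial data set of a spacelike immersion of a chart domain.** For a smooth
spacelike immersion `f : U → (M, g)` of a chart domain `U : Opens E'` and a field `ν` normal to `f`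
with `C^∞` lift, there is an `InitialDataSet` `D = (h, k)` on `U` with `h = f^* g` (the induced
Riemannian metric `inducedRiemannianMetric`, smooth by `contMDiff_pullbackBilin_holds`) and
`k = K_ν` (the second fundamental form with respect to `ν`, sign convention
`K_ν(v, w) = + g(D_v ν, df w)`, made continuous by `LinearMap.toContinuousBilinearMap`; symmetric
by `secondFundamentalForm_comm`, smooth by `contMDiff_bilinSection_of_eq_secondFundamentalForm`).
O'Neill 1983, Ch. 4, p. 97, Lemma 4 and Lemma 4.4; Choquet-Bruhat 2009, Ch. VI, §2–3.
[cite: ONeill1983, Ch. 4, Lemma 4 and Lemma 4.4] -/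
theorem exists_initialDataSet_induced (hfi : g.IsSpacelikeImmersion 𝓘(ℝ, E') f)
    (hn : g.IsNormalTo 𝓘(ℝ, E') f ν)
    (hν : ContMDiff 𝓘(ℝ, E') I.tangent ∞
      (fun x ↦ (TotalSpace.mk' E (f x) (ν x) : TangentBundle I M))) :
    ∃ D : InitialDataSet 𝓘(ℝ, E') U,
      D.h = g.inducedRiemannianMetric f contMDiff_pullbackBilin_holds hfi ∧
      ∀ y : U, (D.k y).toLinearMap₁₂ = g.secondFundamentalForm 𝓘(ℝ, E') f ν y := by
  set Kc : Π y : U, TangentSpace 𝓘(ℝ, E') y →L[ℝ] TangentSpace 𝓘(ℝ, E') y →L[ℝ] ℝ :=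
    fun y ↦ show E' →L[ℝ] E' →L[ℝ] ℝ from
      LinearMap.toContinuousBilinearMap
        (show E' →ₗ[ℝ] E' →ₗ[ℝ] ℝ from g.secondFundamentalForm 𝓘(ℝ, E') f ν y) with hKc_def
  have hKc : ∀ (y : U) (v w : TangentSpace 𝓘(ℝ, E') y),
      Kc y v w = g.secondFundamentalForm 𝓘(ℝ, E') f ν y v w := fun _ _ _ ↦ rfl
  refine ⟨{ h := g.inducedRiemannianMetric f contMDiff_pullbackBilin_holds hfi
            k := Kc
            k_symm := fun y v w ↦ by
              rw [hKc, hKc]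
              exact g.secondFundamentalForm_comm hfi.contMDiff_self hn hν y v w
            contMDiff_k := g.contMDiff_bilinSection_of_eq_secondFundamentalForm
              hfi.contMDiff_self hν Kc hKc }, rfl, fun y ↦ ?_⟩
  exact LinearMap.ext₂ fun v w ↦ hKc y v w

variable [CompleteSpace E']

/-- **The data induced on a spacelike immersed chart domain of a vacuum spacetime form a vacuum
initial data set.** Let `f : U → (Mᵐ⁺¹, g)` be a smooth spacelike immersion of a chart domain
`U : Opens E'`, `dim E' = m`, with a unit normal field `ν` of sign `−1` (timelike) whose lift to
`TM` is `C^∞`, and suppose `Ric(g) = 0` along `f`. Then there is an `InitialDataSet`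
`D = (f^* g, K_ν)` on `U` (`exists_initialDataSet_induced`: `h_y = (f^* g)_y`, `k_y = K_ν(y)`) which
satisfies `R(h) − |k|²_h + (tr_h k)² = 0` and `div_h k − d(tr_h k) = 0` for every proof of the
standing Levi-Civita hypothesis of its metric
(`InitialDataSet.isVacuumConstraintSolution_of_eq_induced`: twice-traced Gauss and traced Codazzi
equations). Choquet-Bruhat 2009, Ch. VI, Thm. 3.3; Bartnik–Isenberg 2004, (2.1)–(2.2) with
`μ = 0`, `J = 0`; Wald 1984, (10.2.28)–(10.2.30). [cite: ChoquetBruhat2009, Ch. VI, Thm. 3.3] -/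
theorem exists_initialDataSet_induced_isVacuumConstraintSolution
    (hfi : g.IsSpacelikeImmersion 𝓘(ℝ, E') f) (hun : g.IsUnitNormal 𝓘(ℝ, E') f ν (-1))
    (hν : ContMDiff 𝓘(ℝ, E') I.tangent ∞
      (fun x ↦ (TotalSpace.mk' E (f x) (ν x) : TangentBundle I M)))
    {m : ℕ} (hm : finrank ℝ E' = m) (hm1 : finrank ℝ E = m + 1)
    (hRic : ∀ y : U, g.ricci (f y) = 0) :
    ∃ D : InitialDataSet 𝓘(ℝ, E') U,
      (∀ y : U, D.h.inner y = g.inducedBilin 𝓘(ℝ, E') f y) ∧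
      (∀ y : U, (D.k y).toLinearMap₁₂ = g.secondFundamentalForm 𝓘(ℝ, E') f ν y) ∧
      ∀ [D.metric.HasLeviCivita], D.IsVacuumConstraintSolution := by
  obtain ⟨D, hDh, hDk⟩ := g.exists_initialDataSet_induced hfi hun.1 hν
  have hDh' : ∀ y : U, D.h.inner y = g.inducedBilin 𝓘(ℝ, E') f y := fun y ↦ by
    rw [hDh, inducedRiemannianMetric_inner]
  refine ⟨D, hDh', hDk, ?_⟩
  intro _
  exact InitialDataSet.isVacuumConstraintSolution_of_eq_induced g D hfi hun hν hm hm1 hRic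
    (fun y v w ↦ by rw [hDh', inducedBilin_apply])
    (fun y v w ↦ by rw [← hDk y]; rfl)

end PseudoRiemannianMetric

end Literature.Geometry.Lorentzian

end
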